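import Literature.AlgebraicGeometry.Shioda1982.ExceptionalQuadruplesComplete
import HarnessLib

/-!
# Shioda 1982 / Meyer–Neutsch 1981: no exceptional quadruple at the level `N = 450` — kernel sweep, part 3 of 8

Topic `Literature/AlgebraicGeometry/Shioda1982`; companion of `ExceptionalQuadruplesComplete.lean` (search `checkB`, soundness
`tabelleOneCompleteAt_of_chunks`, invariant form `exists_mem_reps_of_isExceptionalQuadruple`, statement `TabelleOneCompleteAt`; sources,
method and framing in its module docstring) and of the series `ExceptionalQuadruplesSweep*.lean` (together: every level `2 ≤ N ≤ 180`
that is not a row of Tabelle 1; `…SweepTwoHundredTwenty/…TwoHundredSixty/…ThreeHundredForty.lean`,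
`…SweepTwoHundredFiftyTwo/…ThreeHundredNinetySix/…FourHundredSixtyEight.lean`, `…SweepTwoHundred.lean`: the levels `220, 260, 340`, `252, 396, 468`
and `200` of the families `20p`, `36p`, `40p`; `…Sweep<Level>[Part<K>].lean` for the `{2,3,5,7}`-smooth residual levels
`189, 192, 210, 216, 224, 240, 270, 288, 300, 315, 320, 324, 336, 360, 378, 384, 405, 420, 432, 448` `480 … 630`, and the last three levels
`450, 594, 612` of `(180, 630]` outside the ranges of the tree's character-sum families). THEOREMS only (no definition, no named fact): the same kernel
search at the single level `N = 450`, which carries NO row of [MeyerNeutsch1981Fermatquadrupel, Tabelle 1] (computer-generated there,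
"alle Fermatquadrupel für N ≤ 614 ermittelt", §2 p. 53) and lies above the range `N ≤ 180` of Shioda's table p. 727 — by Aoki's
Theorem C ([Aoki1983], computer-assisted for `181 ≤ m ≤ 672`) there is no exceptional element at any level `> 180`; the files
`ExceptionalQuadruplesSweepFourHundredFiftyPartOne.lean`, `ExceptionalQuadruplesSweepFourHundredFiftyPartTwo.lean`, `ExceptionalQuadruplesSweepFourHundredFiftyPartThree.lean`, `ExceptionalQuadruplesSweepFourHundredFiftyPartFour.lean`, `ExceptionalQuadruplesSweepFourHundredFiftyPartFive.lean`, `ExceptionalQuadruplesSweepFourHundredFiftyPartSix.lean`, `ExceptionalQuadruplesSweepFourHundredFiftyPartSeven.lean`, `ExceptionalQuadruplesSweepFourHundredFifty.lean` make the instance `N = 450` a kernel statement. The search at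
`N = 450` visits 2556600 candidate triples (`φ(450) − 1 = 119` units each), too many for one elaboration of bounded wall time, so the
chunks of first entries are spread over 8 files: `ExceptionalQuadruplesSweepFourHundredFiftyPartOne.lean` — first entries `0 ≤ a < 18` (313740 candidates);
`ExceptionalQuadruplesSweepFourHundredFiftyPartTwo.lean` — first entries `18 ≤ a < 35` (309557 candidates);
`ExceptionalQuadruplesSweepFourHundredFiftyPartThree.lean` — first entries `35 ≤ a < 53` (331590 candidates);
`ExceptionalQuadruplesSweepFourHundredFiftyPartFour.lean` — first entries `53 ≤ a < 70` (307326 candidates);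
`ExceptionalQuadruplesSweepFourHundredFiftyPartFive.lean` — first entries `70 ≤ a < 89` (325479 candidates);
`ExceptionalQuadruplesSweepFourHundredFiftyPartSix.lean` — first entries `89 ≤ a < 110` (323002 candidates);
`ExceptionalQuadruplesSweepFourHundredFiftyPartSeven.lean` — first entries `110 ≤ a < 136` (321818 candidates);
`ExceptionalQuadruplesSweepFourHundredFifty.lean` — first entries `136 ≤ a < 450` (324088 candidates); the last one assembles
`completeAt_fourHundredFifty` (every sorted pair-free primitive Hodge 4-multiset mod `450` is standard) and `not_isExceptionalQuadruple_fourHundredFifty`.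
WHY THIS LEVEL (cell `pub-hfermat`): `450 = 2·3²·5²`: the tree's character-sum families cover the levels `K·p`, `p` a prime above a bound depending on `K`, for
`K ∈ {2, 3, 4, 6, 8, 9, 10, 12, 18, 20, 24, 36, 40}` or `K` a power of `2` or of `3` (`PicardNumber<K>Prime.lean`, `PicardNumberTwoPowerPrime.lean`,
`PicardNumberThreePowPrime.lean`) and the prime-power levels (`PicardNumberPrimePower.lean`); writing `450 = K·p` with `p` prime forces
`K ∈ {90, 150, 225}`, none of them among those `K`. `decide +kernel` only (no `native_decide`).

HONEST FRAMING (cell `pub-hfermat`): explicit algebraic cycles for specific Hodge classes on Fermat/Delsarte varieties; residual open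
instances listed; no claim on general Hodge. These classes are algebraic (Lefschetz (1,1)); certified here is only the emptiness of the
exceptional list at this level.

## References
* [MeyerNeutsch1981Fermatquadrupel] W. Meyer, W. Neutsch, *Fermatquadrupel*, Math. Ann. 256 (1981) 51–62, §2 p. 53, Tabelle 1 p. 54 (no row 450).
* [Shioda1982PicardFermat] T. Shioda, J. Fac. Sci. Univ. Tokyo IA 28 (1982) 725–734, table p. 727 (levels `≤ 180`), Prop. 4 (Q′) p. 729.
* [Aoki1983] N. Aoki, Math. Ann. 266 (1983) 23–54, Thm. C.
-/

namespace Literature.AlgebraicGeometry.Shioda1982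

open Literature.AlgebraicGeometry.HodgeTheory

set_option maxHeartbeats 0 in
/-- **The search at `N = 450` passes on the first entries `35 ≤ a < 53`** (part 3 of 8: 18 chunks, 331590 candidate
triples): every visited sorted quadruple of representatives there fails the Hodge test or is standard (`checkB`; `reps 450 = []`).
[cite: MeyerNeutsch1981Fermatquadrupel, §2 p. 53 ("alle Fermatquadrupel für N ≤ 614 ermittelt") and Tabelle 1 p. 54 (no row 450)]
[cite: Aoki1983, Thm. C] -/
theorem checkB_fourHundredFifty_partThree :
    ∀ p ∈ ([(35, 1), (36, 1), (37, 1), (38, 1), (39, 1), (40, 1), (41, 1), (42, 1), (43, 1), (44, 1), (45, 1), (46, 1), (47, 1), (48, 1), (49, 1), (50, 1), (51, 1), (52, 1)] : List (ℕ × ℕ)), checkB 450 p.1 p.2 = true := by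
  intro p hp
  simp only [List.mem_cons, List.not_mem_nil, or_false] at hp
  rcases hp with rfl | rfl | rfl | rfl | rfl | rfl | rfl | rfl | rfl | rfl | rfl | rfl | rfl | rfl | rfl | rfl | rfl | rfl <;> decide +kernel

end Literature.AlgebraicGeometry.Shioda1982
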